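import Summits.QuantumFields.BalabanUV.T4Continuum.Spine.NE4.FadingFromRateRelAnalytic

/-!
# Spine/NE4/FadingFromRateRelAnalyticUnique — [Balaban1987RG1] Thm 2's tuned bare coupling is UNIQUE from {REAL NE4, relative real-analytic
# charts, the printed upper bound} in the LOG currency: ONE radius, NO asymptotic-freedom lower bound — and the ∃ ⇒ ∀ passage of the targets

Cell `pub-balaban-gaps` (YM blitz G2), seat `ne4`, generation 7 (unit `pub-balaban-gaps-ne4-g7`); record `HOME/ne/NE4.md` §5 (R40), companion of
`Spine/NE4/FadingFromRateRelAnalytic` (headline `histLipschitzLog_fadingMemory_of_localAnalyticRel`: LOG-currency history moduli with γ-free constants)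
and `Spine/NE4/FadingFromRateRelAnalyticU2` (node U2's OUTPUT by the rate-loss fixed point, one radius, no `EventualLowerH`).

THE POINT.  Node U2 has a second consumer besides node U6: the UNIQUENESS of [Balaban1987RG1] Thm 2's tuned bare coupling `g₀(ε, g)`
(`T4TwoRunUniqueness.TunedUniqueBelow D γᵤ`), which turns the ∃-reading of the targets' prefix into the ∀-reading
(`T4TwoRunUniqueness.toAll_of_tunedUniqueBelow`: `UnderHypothesesE → UnderHypotheses`).  The tree derives it from the g-currency companions
(`tunedUniqueBelow_of_fadingMemory`: `HistLipschitz Λ γᵤ` + `FadingMemory C θ Λ` + the printed upper bound + `Cγᵤ³(1+θ) < (1−θ)²`) — but under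
the printed-domain analyticity shape `LocalAnalyticRel` the g-currency moduli may not exist (`Spine/NE4/FadingFromRateRelAnalyticSharp`).  This file
re-runs the SAME-SPACING two-run comparison of `T4TwoRunUniqueness` §1–§2 in ANY currency `φ` with a sup weight (`T4CurrencyMatching.CurrencyWeight φ γ w`):
`disc₀_step_by` (the backward recursion with `HistLipschitzBy φ`), `disc₀_step_fading_by` (+ fading memory: `δ_j ≤ δ_{j+1} + C·w·Σ_{i≤j} θ^{j−i}δ_i`),
`eq_of_pin_fadingMemory_by` (equal pins ⇒ equal histories, by `T4TwoRunUniqueness.weighted_zero`, window `2·C·w·(1+θ) < (1−θ)²`),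
`tunedUniqueBelow_of_histLipschitzLog` (log currency, `w = γ²∕2`: window `C·γᵤ²·(1+θ) < (1−θ)²` — γ²-TYPE), and from (R40)'s headline
`tunedUniqueBelow_of_localAnalyticRel`: {REAL NE4 for the data, `LocalAnalyticRel B γᵤ ρ D.βfun`, `BetaUpperH β′ γᵤ` with `γᵤ²β′ < 1`} ⟹
`TunedUniqueBelow D (min γᵤ γ⋆)` with `γ⋆ = min(1, (1−θ′)²∕(4(C₂(θ′)+1)))` γᵤ-FREE — ONE radius, NO `EventualLowerH`; finally
`underHypotheses_of_E_localAnalyticRel` (the ∃ ⇒ ∀ passage under these binders).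

HONEST FRAMING: bookkeeping over hypothesis shapes (NE4, `LocalAnalyticRel`, the upper bound are BINDERS, UNPRINTED except the upper bound's TYPE);
nothing of Bałaban's asserted; [Balaban1987RG1] Thm 2 itself is NOT proved (existence of the tuned coupling is binder B3); NE4 NOT IN PRINT, NOT PROVED;
0∕6, 0∕9; NOT continuum on ℝ⁴, NOT infinite volume, NOT a mass gap, NOT Clay.  0 sorry, 0 def; axioms standard; imports `Spine/NE4/FadingFromRateRelAnalytic`.
Reference (TYPES only): [Balaban1987RG1] = T. Bałaban, CMP **109** (1987) 249–301, (0.20) p. 256, Thm 2 p. 259.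
-/

noncomputable section

namespace Summit.QuantumFields.BalabanUV.T4Continuum.Spine.NE4

open Set Finset
open Literature.MathematicalPhysics.QuantumFieldTheory.Balaban1983to89
open Literature.MathematicalPhysics.QuantumFieldTheory.Balaban1983to89.FlowStep
open Literature.MathematicalPhysics.QuantumFieldTheory.Balaban1983to89.T4CouplingMatching
open Literature.MathematicalPhysics.QuantumFieldTheory.Balaban1983to89.T4Continuum
open Literature.MathematicalPhysics.QuantumFieldTheory.Balaban1983to89.T4CurrencyMatching
  (HistLipschitzBy CurrencyWeight currencyWeight_log)
open Literature.MathematicalPhysics.QuantumFieldTheory.Balaban1983to89.T4TwoRunUniqueness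
  (disc₀ disc₀_nonneg disc₀_pin eq_of_disc₀_eq_zero weighted_zero TunedUniqueBelow toAll_of_tunedUniqueBelow rgEqH_of_tuned)

/-! ## §1 The same-spacing backward recursion in a currency `φ` -/

/-- THE BACKWARD RECURSION AT EQUAL SPACINGS IN THE CURRENCY `φ` (cf. `T4TwoRunUniqueness.disc₀_step`, the `φ = id` case): two runs of (0.20) of the
same length `K`, all couplings in `]0,γ]`; for `j < K`, `δ_j ≤ δ_{j+1} + Σ_{i≤j} Λ j i·|φ(g^A_i) − φ(g^B_i)|`, `δ = disc₀ gA gB`, under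
`HistLipschitzBy φ Λ γ β` (NOT PRINTED). [cite: Balaban1987RG1, (0.20) p.256] -/
theorem disc₀_step_by {β : HBeta} {φ : ℝ → ℝ} {γ : ℝ} {Λ : ℕ → ℕ → ℝ} {K : ℕ} {gA gB : ℕ → ℝ}
    (hA : RGEqH K β gA) (hB : RGEqH K β gB)
    (hAbox : ∀ i, i ≤ K → 0 < gA i ∧ gA i ≤ γ) (hBbox : ∀ i, i ≤ K → 0 < gB i ∧ gB i ≤ γ)
    (hL : HistLipschitzBy φ Λ γ β) {j : ℕ} (hj : j < K) :
    disc₀ gA gB j ≤ disc₀ gA gB (j + 1) + ∑ i ∈ range (j + 1), Λ j i * |φ (gA i) - φ (gB i)| := by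
  have eA := hA j hj
  have eB := hB j hj
  have hpA : prefixOf gA j ∈ Box γ j := prefixOf_mem_box hj.le hAbox
  have hpB : prefixOf gB j ∈ Box γ j := prefixOf_mem_box hj.le hBbox
  have h2 := hL j (prefixOf gA j) (prefixOf gB j) hpA hpB
  have h3 : ∑ i ∈ range (j + 1), Λ j i * |φ (gA i) - φ (gB i)|
      = ∑ i : Fin (j + 1), Λ j i * |φ (prefixOf gA j i) - φ (prefixOf gB j i)| := by
    rw [Finset.sum_range (fun i => Λ j i * |φ (gA i) - φ (gB i)|)]
    simp only [prefixOf_apply]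
  have key : 1 / gA j ^ 2 - 1 / gB j ^ 2
      = (1 / gA (j + 1) ^ 2 - 1 / gB (j + 1) ^ 2) + (β j (prefixOf gA j) - β j (prefixOf gB j)) := by
    rw [eA, eB]
    ring
  have habs : disc₀ gA gB j ≤ disc₀ gA gB (j + 1) + |β j (prefixOf gA j) - β j (prefixOf gB j)| := by
    simp only [disc₀]
    rw [key]
    exact abs_add_le _ _
  linarith [habs, h2, h3]

/-- The recursion with FADING MEMORY and the currency's SUP WEIGHT (`CurrencyWeight φ γ w`: `|φ a − φ b| ≤ w·|1∕a² − 1∕b²|` on `]0,γ]`):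
`δ_j ≤ δ_{j+1} + C·w·Σ_{i≤j} θ^{j−i}δ_i`.  In the log currency `w = γ²∕2` (`currencyWeight_log`); compare `disc₀_step_fading'` (`φ = id`, `w = γ³∕2`).
[cite: Balaban1987RG1, (0.20) p.256 and §5 p.298] -/
theorem disc₀_step_fading_by {β : HBeta} {φ : ℝ → ℝ} {γ C θ w : ℝ} {Λ : ℕ → ℕ → ℝ} {K : ℕ} {gA gB : ℕ → ℝ}
    (hA : RGEqH K β gA) (hB : RGEqH K β gB)
    (hAbox : ∀ i, i ≤ K → 0 < gA i ∧ gA i ≤ γ) (hBbox : ∀ i, i ≤ K → 0 < gB i ∧ gB i ≤ γ)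
    (hL : HistLipschitzBy φ Λ γ β) (hΛ : FadingMemory C θ Λ) (hφ : CurrencyWeight φ γ w) (hw : 0 ≤ w) {j : ℕ} (hj : j < K) :
    disc₀ gA gB j ≤ disc₀ gA gB (j + 1) + C * w * ∑ i ∈ range (j + 1), θ ^ (j - i) * disc₀ gA gB i := by
  have hstep := disc₀_step_by hA hB hAbox hBbox hL hj
  have hsum : ∑ i ∈ range (j + 1), Λ j i * |φ (gA i) - φ (gB i)|
      ≤ C * w * ∑ i ∈ range (j + 1), θ ^ (j - i) * disc₀ gA gB i := by
    rw [Finset.mul_sum]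
    refine Finset.sum_le_sum fun i hi => ?_
    have hij : i ≤ j := Nat.lt_succ_iff.mp (mem_range.mp hi)
    have hiK : i ≤ K := by omega
    have hgA := hAbox i hiK
    have hgB := hBbox i hiK
    have hcw : |φ (gA i) - φ (gB i)| ≤ w * disc₀ gA gB i := by
      have h := hφ (gA i) (gB i) hgA.1 hgA.2 hgB.1 hgB.2
      simpa [disc₀, one_div] using h
    have hnn : 0 ≤ w * disc₀ gA gB i := mul_nonneg hw (disc₀_nonneg _ _ _)
    calc Λ j i * |φ (gA i) - φ (gB i)| ≤ Λ j i * (w * disc₀ gA gB i) := mul_le_mul_of_nonneg_left hcw (hΛ j i hij).1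
      _ ≤ C * θ ^ (j - i) * (w * disc₀ gA gB i) := mul_le_mul_of_nonneg_right (hΛ j i hij).2 hnn
      _ = C * w * (θ ^ (j - i) * disc₀ gA gB i) := by ring
  linarith [hstep, hsum]

/-! ## §2 Equal pins ⇒ equal histories, in a currency -/

/-- **EQUAL PINS ⇒ EQUAL HISTORIES IN THE CURRENCY `φ`.**  Two runs of (0.20) of the same length `K` in `]0,γ]` with `g^A_K = g^B_K`, under
`HistLipschitzBy φ Λ γ β`, `FadingMemory C θ Λ` (`0 ≤ θ < 1`), `CurrencyWeight φ γ w` (`w ≥ 0`) and the window `2·C·w·(1+θ) < (1−θ)²`, coincide at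
every scale (`T4TwoRunUniqueness.weighted_zero` with `a = C·w`, `ρ = 2∕(1+θ)`; the `φ = id` case is `eq_of_pin_fadingMemory`).
[cite: Balaban1987RG1, (0.20) p.256 and Thm 2 p.259] -/
theorem eq_of_pin_fadingMemory_by {β : HBeta} {φ : ℝ → ℝ} {γ C θ w : ℝ} {Λ : ℕ → ℕ → ℝ} {K : ℕ} {gA gB : ℕ → ℝ}
    (hθ0 : 0 ≤ θ) (hθ1 : θ < 1) (hw : 0 ≤ w) (hsmall : 2 * (C * w) * (1 + θ) < (1 - θ) ^ 2)
    (hA : RGEqH K β gA) (hB : RGEqH K β gB)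
    (hAbox : ∀ i, i ≤ K → 0 < gA i ∧ gA i ≤ γ) (hBbox : ∀ i, i ≤ K → 0 < gB i ∧ gB i ≤ γ)
    (hpin : gA K = gB K) (hL : HistLipschitzBy φ Λ γ β) (hΛ : FadingMemory C θ Λ) (hφ : CurrencyWeight φ γ w) :
    ∀ j, j ≤ K → gA j = gB j := by
  have hC : 0 ≤ C := by have h := (hΛ 0 0 le_rfl).2; simpa using (hΛ 0 0 le_rfl).1.trans h
  have ha : 0 ≤ C * w := mul_nonneg hC hw
  have h1θ : 0 < 1 + θ := by linarith
  have hρ1 : 1 < 2 / (1 + θ) := by rw [lt_div_iff₀ h1θ]; linarith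
  have hρθ : 2 / (1 + θ) * θ < 1 := by rw [div_mul_eq_mul_div, div_lt_one h1θ]; linarith
  have hq : C * w * (2 / (1 + θ)) < (1 - 2 / (1 + θ) * θ) * (2 / (1 + θ) - 1) := by
    have e1 : C * w * (2 / (1 + θ)) = 2 * (C * w) * (1 + θ) / (1 + θ) ^ 2 := by field_simp
    have e2 : (1 - 2 / (1 + θ) * θ) * (2 / (1 + θ) - 1) = (1 - θ) ^ 2 / (1 + θ) ^ 2 := by field_simp; ring
    rw [e1, e2]
    exact div_lt_div_of_pos_right hsmall (by positivity)
  have hz := weighted_zero (δ := disc₀ gA gB) hθ0 hρ1 hρθ ha hq (disc₀_nonneg gA gB) (disc₀_pin hpin)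
    (fun j hj => disc₀_step_fading_by hA hB hAbox hBbox hL hΛ hφ hw hj)
  intro j hj
  exact eq_of_disc₀_eq_zero (hAbox j hj).1 (hBbox j hj).1 (hz j hj)

/-! ## §3 Tuned uniqueness on the data in the log currency, and from relative charts -/

universe u

variable {F : T4Family} {G : Type u} [GaugeGroup G] [MeasurableSpace G] [HaarData G]

/-- **`TunedUniqueBelow` IN THE LOG CURRENCY — γ²-TYPE WINDOW, NO `EventualLowerH`.**  Under `HistLipschitzBy Real.log Λ γᵤ D.βfun`,
`FadingMemory C θ Λ` (`0 ≤ θ < 1`), the printed-type upper bound `BetaUpperH β′ γᵤ D.βfun` with `γᵤ²β′ < 1`, and `C·γᵤ²·(1+θ) < (1−θ)²`: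
two sequences tuned to the same `g` within `]0,γ]`, `γ ≤ γᵤ`, coincide ([Balaban1987RG1] Thm 2's `g₀(ε, g)` is unique).  Compare
`T4TwoRunUniqueness.tunedUniqueBelow_of_fadingMemory` (g-currency, window `Cγᵤ³(1+θ) < (1−θ)²`) and `…_of_eventualLower`.
[cite: Balaban1987RG1, Thm 2 p.259] -/
theorem tunedUniqueBelow_of_histLipschitzLog (D : FiniteEpsData F G) {Λ : ℕ → ℕ → ℝ} {C θ β' γu : ℝ}
    (hL : HistLipschitzBy Real.log Λ γu D.βfun) (hΛ : FadingMemory C θ Λ) (hθ0 : 0 ≤ θ) (hθ1 : θ < 1)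
    (hhi : BetaUpperH β' γu D.βfun) (hγβ : γu ^ 2 * β' < 1) (hsmall : C * γu ^ 2 * (1 + θ) < (1 - θ) ^ 2) :
    TunedUniqueBelow D γu := by
  intro γ g g₀ g₀' hγ hγle ht ht'
  have hC : 0 ≤ C := by have h := (hΛ 0 0 le_rfl).2; simpa using (hΛ 0 0 le_rfl).1.trans h
  have hL' : HistLipschitzBy Real.log Λ γ D.βfun := fun k p q hp hq => hL k p q (box_mono hγle k hp) (box_mono hγle k hq)
  have hsmall' : 2 * (C * (γ ^ 2 / 2)) * (1 + θ) < (1 - θ) ^ 2 := by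
    have hγ2 : γ ^ 2 ≤ γu ^ 2 := pow_le_pow_left₀ hγ.le hγle 2
    have h1 : 2 * (C * (γ ^ 2 / 2)) * (1 + θ) = C * γ ^ 2 * (1 + θ) := by ring
    rw [h1]
    exact lt_of_le_of_lt (mul_le_mul_of_nonneg_right (mul_le_mul_of_nonneg_left hγ2 hC) (by linarith)) hsmall
  funext K
  have hA := rgEqH_of_tuned D hhi hγβ hγ hγle ht K
  have hB := rgEqH_of_tuned D hhi hγβ hγ hγle ht' K
  have h := eq_of_pin_fadingMemory_by hθ0 hθ1 (by positivity) hsmall' hA hB (ht K).1 (ht' K).1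
    ((ht K).2.trans (ht' K).2.symm) hL' hΛ (currencyWeight_log hγ) 0 (Nat.zero_le _)
  rwa [D.flow_zero K (g₀ K), D.flow_zero K (g₀' K)] at h

/-- **TUNED UNIQUENESS FROM THE REAL NE4 + RELATIVE CHARTS — ONE RADIUS, NO ASYMPTOTIC-FREEDOM LOWER BOUND.**  `NE4OnData D c θ γᵤ`,
`LocalAnalyticRel B γᵤ ρ D.βfun` (`B > 0`, `0 < ρ ≤ 1`), the printed-type upper bound with `γᵤ²β′ < 1`, and a memory rate `θ′ ∈ ]θ,1[` give
`TunedUniqueBelow D (min γᵤ γ⋆)` with the γᵤ-FREE threshold `γ⋆ = min(1, (1−θ′)²∕(4(C₂+1)))`, `C₂ = relAnalyticFading c θ B ρ θ′` — by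
`histLipschitzLog_fadingMemory_of_localAnalyticRel` and `tunedUniqueBelow_of_histLipschitzLog`.  Every β-side input UNPRINTED except the upper bound's TYPE.
[cite: Balaban1987RG1, Thm 2 p.259] -/
theorem tunedUniqueBelow_of_localAnalyticRel (D : FiniteEpsData F G) {c θ θ' γu ρ B β' : ℝ}
    (hL : LocalAnalyticRel B γu ρ D.βfun) (hN : NE4OnData D c θ γu) (hc : 0 ≤ c) (hθ0 : 0 < θ) (hθ1 : θ < 1) (hB : 0 < B)
    (hρ : 0 < ρ) (hρ1 : ρ ≤ 1) (hγu : 0 < γu) (hθθ' : θ < θ') (hθ'1 : θ' < 1)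
    (hhi : BetaUpperH β' γu D.βfun) (hγβ : γu ^ 2 * β' < 1) :
    TunedUniqueBelow D (min γu (min 1 ((1 - θ') ^ 2 / (4 * (relAnalyticFading c θ B ρ θ' + 1))))) := by
  obtain ⟨hHL, hF⟩ := histLipschitzLog_fadingMemory_of_localAnalyticRel hL hN hc hθ0 hθ1 hB hρ hρ1 hγu
  set C₂ : ℝ := relAnalyticFading c θ B ρ θ' with hC₂
  have hC : 0 ≤ C₂ := relAnalyticFading_nonneg hc hθ0 hθ1 hρ θ'
  set γ₁ : ℝ := min γu (min 1 ((1 - θ') ^ 2 / (4 * (C₂ + 1)))) with hγ₁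
  have hγ₁u : γ₁ ≤ γu := min_le_left _ _
  have hγ₁1 : γ₁ ≤ 1 := (min_le_right _ _).trans (min_le_left _ _)
  have hγ₁W : γ₁ ≤ (1 - θ') ^ 2 / (4 * (C₂ + 1)) := (min_le_right _ _).trans (min_le_right _ _)
  have hγ₁0 : 0 < γ₁ := lt_min hγu (lt_min one_pos (div_pos (pow_pos (by linarith) 2) (by positivity)))
  have hL₁ : HistLipschitzBy Real.log (relAnalyticModuli c θ B ρ) γ₁ D.βfun := fun k p q hp hq =>
    hHL k p q (box_mono hγ₁u k hp) (box_mono hγ₁u k hq)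
  have hhi₁ : BetaUpperH β' γ₁ D.βfun := fun k v hv => hhi k v (box_mono hγ₁u k hv)
  have hγβ₁ : γ₁ ^ 2 * β' < 1 := by
    rcases le_or_gt β' 0 with hb | hb
    · exact lt_of_le_of_lt (mul_nonpos_of_nonneg_of_nonpos (sq_nonneg γ₁) hb) one_pos
    · exact lt_of_le_of_lt (mul_le_mul_of_nonneg_right (pow_le_pow_left₀ hγ₁0.le hγ₁u 2) hb.le) hγβ
  have hwin : C₂ * γ₁ ^ 2 * (1 + θ') < (1 - θ') ^ 2 := by
    have hsq : γ₁ ^ 2 ≤ γ₁ := by nlinarith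
    have h4 : γ₁ * (4 * (C₂ + 1)) ≤ (1 - θ') ^ 2 := (le_div_iff₀ (by positivity)).mp hγ₁W
    have hpos : 0 < (1 - θ') ^ 2 := pow_pos (by linarith) 2
    nlinarith [mul_nonneg hC (sq_nonneg γ₁), mul_nonneg hC hγ₁0.le]
  exact tunedUniqueBelow_of_histLipschitzLog D hL₁ (hF θ' hθθ') (hθ0.trans hθθ').le hθ'1 hhi₁ hγβ₁ hwin

/-- **THE ∃-READING IMPLIES THE ∀-READING under {REAL NE4, relative charts, the printed upper bound}** (cf.
`T4TwoRunUniqueness.underHypotheses_of_E_fadingMemory`): for every β-side hypothesis `Hβ` and conclusion `c`,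
`D.UnderHypothesesE Hβ c → D.UnderHypotheses Hβ c` — Thm 2's "g₀ = g₀(ε, g)" read with ∃ or with ∀ agree under these binders.
[cite: Balaban1987RG1, Thm 2 p.259] -/
theorem underHypotheses_of_E_localAnalyticRel (D : FiniteEpsData F G) {Hβ : Prop} {cc : (ℕ → ℝ) → Prop}
    {c θ θ' γu ρ B β' : ℝ} (hL : LocalAnalyticRel B γu ρ D.βfun) (hN : NE4OnData D c θ γu) (hc : 0 ≤ c) (hθ0 : 0 < θ)
    (hθ1 : θ < 1) (hB : 0 < B) (hρ : 0 < ρ) (hρ1 : ρ ≤ 1) (hγu : 0 < γu) (hθθ' : θ < θ') (hθ'1 : θ' < 1)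
    (hhi : BetaUpperH β' γu D.βfun) (hγβ : γu ^ 2 * β' < 1) (h : D.UnderHypothesesE Hβ cc) : D.UnderHypotheses Hβ cc := by
  have hC : 0 ≤ relAnalyticFading c θ B ρ θ' := relAnalyticFading_nonneg hc hθ0 hθ1 hρ θ'
  have hpos : 0 < min γu (min 1 ((1 - θ') ^ 2 / (4 * (relAnalyticFading c θ B ρ θ' + 1)))) :=
    lt_min hγu (lt_min one_pos (div_pos (pow_pos (by linarith) 2) (by positivity)))
  exact toAll_of_tunedUniqueBelow hpos
    (tunedUniqueBelow_of_localAnalyticRel D hL hN hc hθ0 hθ1 hB hρ hρ1 hγu hθθ' hθ'1 hhi hγβ) h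

end Summit.QuantumFields.BalabanUV.T4Continuum.Spine.NE4

end
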